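import Mathlib
import HarnessLib
import Literature.MathematicalPhysics.QuantumLattice.ScaleZeroMultiplierBandPieces
import Summits.HubbardSuperconductivity.HubbardSuperconductivity.Theorems.KLProgrammeKLRegimeEngineScaleZeroE4SpaceMoment

/-!
# KL programme (k = 3, c = 2, p1 g3) — ENGINE (E4)₀: the scale bookkeeping of the telescoped MULTIPLIER space moment (`T_X`, part 2)

Helpers toward the item `KLRegimeEngineV16` (conjunct (E4)₀ of `stub_engine_scale0`).  The multiplier twin of §1–§2 of
`…ScaleZeroE4SpaceMoment`: at its own scale `R_m = 4ᵐ` the `m`-th multiplier increment has amplitudes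
`multAmp B klE0 (D_c·2ᵐ) WK_m t (1+k')` with the PRODUCT derivative table `WK_m(i) = C_A·Σ_{j'≤i} C(i,j')·Gfr_{j'}·u_{j'}(U)·(2ᵐ)^{2j'}/(2ᵐ)⁴`
(`norm_iteratedFDeriv_framePiece_mul_angular_le`); every term of the scaled amplitude is `O(U²)` or `O(|U|·2^{-m})`:

* `scale_bracket_le_one_of_le`, `scale_bracket_le_inv_of_zero` — the bracket `Y²(1/(4Y²))^{k'}Yʲ(Y^{2d}/Y⁴)` for `j + d ≤ k'+1`;
* **`scaled_mult_sum_le`** — `Y²(1/(4Y²))^{k'}·Σ_j C(k,j)j!(D_cY)ʲ·WK_m(k−j) ≤ C_A·36864·S⁴·(U² + |U|/2ᵐ)`;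
* **`scaledMultAmp_le`** — for p4's amplitude table `multAmp` (Literature `ScaleZeroMultiplierBandPieces`).
-/

noncomputable section

namespace Summit.HubbardSuperconductivity.HubbardSuperconductivity.Theorems.EngineV8

set_option linter.dupNamespace false -- summit = problem name (single-conjunct summit), D-0017

open Real Finset Literature.MathematicalPhysics.QuantumLattice Literature.Probability.LatticeModels
open Summit.HubbardSuperconductivity.HubbardSuperconductivity.Theorems.KLRegimeSplit
open scoped Nat

/-! ## §1 The scale bracket for `j + d ≤ k' + 1` -/

/-- The bracket with a SMALLER `d` is at most `1`: `Y²(1/(4Y²))^{k'}Yʲ(Y^{2d}/Y⁴) ≤ 1` for `j + d ≤ k'+1`, `Y ≥ 1`. -/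
theorem scale_bracket_le_one_of_le {Y : ℝ} (hY : 1 ≤ Y) {k' j d : ℕ} (hjd : j + d ≤ k' + 1) :
    Y ^ 2 * (1 / (4 * Y ^ 2)) ^ k' * Y ^ j * (Y ^ (2 * d) / Y ^ 4) ≤ 1 := by
  have hY0 : 0 < Y := by positivity
  set d₀ := k' + 1 - j with hd₀
  have hjd₀ : j + d₀ = k' + 1 := by omega
  have hmono : Y ^ (2 * d) ≤ Y ^ (2 * d₀) := pow_le_pow_right₀ hY (by omega)
  have h0 : 0 ≤ Y ^ 2 * (1 / (4 * Y ^ 2)) ^ k' * Y ^ j := by positivity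
  calc Y ^ 2 * (1 / (4 * Y ^ 2)) ^ k' * Y ^ j * (Y ^ (2 * d) / Y ^ 4)
      ≤ Y ^ 2 * (1 / (4 * Y ^ 2)) ^ k' * Y ^ j * (Y ^ (2 * d₀) / Y ^ 4) :=
        mul_le_mul_of_nonneg_left (div_le_div_of_nonneg_right hmono (by positivity)) h0
    _ ≤ (1 / Y) ^ j := scale_bracket_le hY hjd₀
    _ ≤ 1 := pow_le_one₀ (by positivity) (div_le_one_of_le₀ hY hY0.le)

/-- The bracket with `d = 0` gains a factor `1/Y`: `Y²(1/(4Y²))^{k'}Yʲ(1/Y⁴) ≤ 1/Y` for `j ≤ k'+1`, `Y ≥ 1`. -/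
theorem scale_bracket_le_inv_of_zero {Y : ℝ} (hY : 1 ≤ Y) {k' j : ℕ} (hj : j ≤ k' + 1) :
    Y ^ 2 * (1 / (4 * Y ^ 2)) ^ k' * Y ^ j * (Y ^ (2 * 0) / Y ^ 4) ≤ 1 / Y := by
  have hY0 : 0 < Y := by positivity
  rcases Nat.eq_zero_or_pos j with rfl | hj1
  · -- `j = 0`: the bracket is `(1/(4Y²))^{k'}/Y² ≤ 1/Y² ≤ 1/Y`
    have h1 : (1 / (4 * Y ^ 2)) ^ k' ≤ 1 := pow_le_one₀ (by positivity) (by rw [div_le_one (by positivity)]; nlinarith)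
    rw [mul_zero, pow_zero, mul_one]
    calc Y ^ 2 * (1 / (4 * Y ^ 2)) ^ k' * (1 / Y ^ 4) ≤ Y ^ 2 * 1 * (1 / Y ^ 4) :=
          mul_le_mul_of_nonneg_right (mul_le_mul_of_nonneg_left h1 (by positivity)) (by positivity)
      _ = 1 / Y * (1 / Y) := by field_simp
      _ ≤ 1 / Y * 1 := mul_le_mul_of_nonneg_left (div_le_one_of_le₀ hY hY0.le) (by positivity)
      _ = 1 / Y := mul_one _
  · -- `j ≥ 1`: compare with the exact bracket at `d₀ = k'+1−j`
    set d₀ := k' + 1 - j with hd₀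
    have hjd₀ : j + d₀ = k' + 1 := by omega
    have hmono : Y ^ (2 * 0) ≤ Y ^ (2 * d₀) := pow_le_pow_right₀ hY (by omega)
    have h0 : 0 ≤ Y ^ 2 * (1 / (4 * Y ^ 2)) ^ k' * Y ^ j := by positivity
    calc Y ^ 2 * (1 / (4 * Y ^ 2)) ^ k' * Y ^ j * (Y ^ (2 * 0) / Y ^ 4)
        ≤ Y ^ 2 * (1 / (4 * Y ^ 2)) ^ k' * Y ^ j * (Y ^ (2 * d₀) / Y ^ 4) :=
          mul_le_mul_of_nonneg_left (div_le_div_of_nonneg_right hmono (by positivity)) h0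
      _ ≤ (1 / Y) ^ j := scale_bracket_le hY hjd₀
      _ ≤ (1 / Y) ^ 1 := pow_le_pow_of_le_one (by positivity) (div_le_one_of_le₀ hY hY0.le) hj1
      _ = 1 / Y := pow_one _

/-! ## §2 The scaled amplitudes of the multiplier increments -/

section Pieces

variable {R : RenConsts} {U : ℝ} {B CA : ℝ}

/-- **The inner double sum of the multiplier increment amplitude, scaled**: with `Y = 2ᵐ`, `D = D_c·Y`,
`WK(i) = C_A·Σ_{j'≤i} C(i,j')·Gfr_{j'}·u_{j'}(U)·Y^{2j'}/Y⁴`, `S = 1 + ΣGfr`, for `k = 1 + k' ≤ 3`: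
`Y²(1/(4Y²))^{k'}·Σ_{j≤k} C(k,j)·j!·Dʲ·WK(k−j) ≤ C_A·36864·S⁴·(U² + |U|·(1/2)ᵐ)` (`R.WF`, `C_A ≥ 0`). -/
theorem scaled_mult_sum_le (hRwf : R.WF) (hCA0 : 0 ≤ CA) (m : ℕ) {k' : ℕ} (hk' : k' ≤ 2) :
    ((2 : ℝ) ^ m) ^ 2 * (1 / (4 * ((2 : ℝ) ^ m) ^ 2)) ^ k' *
        ∑ j ∈ range (1 + k' + 1), ((1 + k').choose j : ℝ) * (j.factorial : ℝ) *
          ((4 + 4 / 3 * (R.Gfr 1 + R.Gfr 2 + R.Gfr 3)) * (2 : ℝ) ^ m) ^ j *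
            (CA * ∑ j' ∈ range (1 + k' - j + 1), ((1 + k' - j).choose j' : ℝ) *
              (R.Gfr j' * uPow j' U * (((2 : ℝ) ^ m) ^ (2 * j') / ((2 : ℝ) ^ m) ^ 4))) ≤
      CA * (36864 * (1 + R.Gfr 0 + R.Gfr 1 + R.Gfr 2 + R.Gfr 3) ^ 4 * (U ^ 2 + |U| * (1 / 2 : ℝ) ^ m)) := by
  have hG0 : ∀ j, 0 ≤ R.Gfr j := hRwf.2.2
  set Y : ℝ := (2 : ℝ) ^ m with hYdef
  have hY1 : 1 ≤ Y := one_le_pow₀ (by norm_num)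
  have hY0 : 0 < Y := by positivity
  set S : ℝ := 1 + R.Gfr 0 + R.Gfr 1 + R.Gfr 2 + R.Gfr 3 with hSdef
  have hS1 : 1 ≤ S := by rw [hSdef]; linarith [hG0 0, hG0 1, hG0 2, hG0 3]
  have hS0 : 0 ≤ S := by linarith
  have hGS : ∀ i ≤ 3, R.Gfr i ≤ S := by
    intro i hi; interval_cases i <;> rw [hSdef] <;> linarith [hG0 0, hG0 1, hG0 2, hG0 3]
  set Dc : ℝ := 4 + 4 / 3 * (R.Gfr 1 + R.Gfr 2 + R.Gfr 3) with hDc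
  have hDc1 : 1 ≤ Dc := by rw [hDc]; nlinarith [hG0 1, hG0 2, hG0 3]
  have hDcS : Dc ≤ 4 * S := by rw [hDc, hSdef]; nlinarith [hG0 0, hG0 1, hG0 2, hG0 3]
  have hDcj : ∀ j ≤ 3, Dc ^ j ≤ 64 * S ^ 3 := by
    intro j hj
    calc Dc ^ j ≤ Dc ^ 3 := pow_le_pow_right₀ hDc1 hj
      _ ≤ (4 * S) ^ 3 := pow_le_pow_left₀ (by linarith) hDcS 3
      _ = 64 * S ^ 3 := by ring
  -- the bracketed inner terms: `u_{j'}·bracket(j, j') ≤ U² + |U|/2ᵐ` for `j + j' ≤ k'+1`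
  have hub : ∀ j j' : ℕ, j + j' ≤ k' + 1 →
      uPow j' U * (Y ^ 2 * (1 / (4 * Y ^ 2)) ^ k' * Y ^ j * (Y ^ (2 * j') / Y ^ 4)) ≤ U ^ 2 + |U| * (1 / 2 : ℝ) ^ m := by
    intro j j' hjj'
    have hbr0 : 0 ≤ Y ^ 2 * (1 / (4 * Y ^ 2)) ^ k' * Y ^ j * (Y ^ (2 * j') / Y ^ 4) := by positivity
    unfold uPow
    split_ifs with hd0
    · subst hd0
      have h1 := scale_bracket_le_inv_of_zero hY1 (k' := k') (j := j) (by omega)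
      have h2 : 1 / Y = (1 / 2 : ℝ) ^ m := by rw [hYdef, one_div_pow]
      rw [h2] at h1
      nlinarith [abs_nonneg U, sq_nonneg U, h1, hbr0]
    · have h1 := scale_bracket_le_one_of_le hY1 hjj'
      nlinarith [abs_nonneg U, sq_nonneg U, h1, hbr0, show 0 ≤ |U| * (1 / 2 : ℝ) ^ m by positivity]
  -- the inner sums: `Σ_{j'≤d} C(d,j')·Gfr_{j'}·u_{j'}·(Y^{2j'}/Y⁴)·bracket_j ≤ 8·S·(U² + |U|/2ᵐ)`
  have hinner : ∀ j ∈ range (1 + k' + 1),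
      (∑ j' ∈ range (1 + k' - j + 1), ((1 + k' - j).choose j' : ℝ) *
          (R.Gfr j' * uPow j' U * (Y ^ (2 * j') / Y ^ 4))) * (Y ^ 2 * (1 / (4 * Y ^ 2)) ^ k' * Y ^ j) ≤
        8 * S * (U ^ 2 + |U| * (1 / 2 : ℝ) ^ m) := by
    intro j hj
    have hjk : j ≤ 1 + k' := by have := mem_range.1 hj; omega
    rw [sum_mul]
    have hterm : ∀ j' ∈ range (1 + k' - j + 1), ((1 + k' - j).choose j' : ℝ) *
        (R.Gfr j' * uPow j' U * (Y ^ (2 * j') / Y ^ 4)) * (Y ^ 2 * (1 / (4 * Y ^ 2)) ^ k' * Y ^ j) ≤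
        ((1 + k' - j).choose j' : ℝ) * (S * (U ^ 2 + |U| * (1 / 2 : ℝ) ^ m)) := by
      intro j' hj'
      have hj'd : j' ≤ 1 + k' - j := by have := mem_range.1 hj'; omega
      have hu0 : 0 ≤ uPow j' U := by unfold uPow; split_ifs <;> positivity
      have h1 := hub j j' (by omega)
      have hG := hGS j' (by omega)
      calc ((1 + k' - j).choose j' : ℝ) * (R.Gfr j' * uPow j' U * (Y ^ (2 * j') / Y ^ 4)) * (Y ^ 2 * (1 / (4 * Y ^ 2)) ^ k' * Y ^ j)
          = ((1 + k' - j).choose j' : ℝ) * (R.Gfr j' *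
              (uPow j' U * (Y ^ 2 * (1 / (4 * Y ^ 2)) ^ k' * Y ^ j * (Y ^ (2 * j') / Y ^ 4)))) := by ring
        _ ≤ ((1 + k' - j).choose j' : ℝ) * (S * (U ^ 2 + |U| * (1 / 2 : ℝ) ^ m)) := by
            refine mul_le_mul_of_nonneg_left (mul_le_mul hG h1 (by positivity) hS0) (Nat.cast_nonneg _)
    refine (sum_le_sum hterm).trans ?_
    rw [← sum_mul]
    have hbin : ∑ j' ∈ range (1 + k' - j + 1), ((1 + k' - j).choose j' : ℝ) ≤ 8 := by
      have h := Nat.sum_range_choose (1 + k' - j)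
      have h8 : 2 ^ (1 + k' - j) ≤ 8 := by
        calc 2 ^ (1 + k' - j) ≤ 2 ^ 3 := Nat.pow_le_pow_right (by norm_num) (by omega)
          _ = 8 := by norm_num
      exact_mod_cast h ▸ h8
    calc (∑ j' ∈ range (1 + k' - j + 1), ((1 + k' - j).choose j' : ℝ)) * (S * (U ^ 2 + |U| * (1 / 2 : ℝ) ^ m))
        ≤ 8 * (S * (U ^ 2 + |U| * (1 / 2 : ℝ) ^ m)) := mul_le_mul_of_nonneg_right hbin (by positivity)
      _ = 8 * S * (U ^ 2 + |U| * (1 / 2 : ℝ) ^ m) := by ring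
  -- the outer terms
  have hterm : ∀ j ∈ range (1 + k' + 1), ((1 + k').choose j : ℝ) * (j.factorial : ℝ) * (Dc * Y) ^ j *
      (CA * ∑ j' ∈ range (1 + k' - j + 1), ((1 + k' - j).choose j' : ℝ) *
        (R.Gfr j' * uPow j' U * (Y ^ (2 * j') / Y ^ 4))) * (Y ^ 2 * (1 / (4 * Y ^ 2)) ^ k') ≤
      CA * (9216 * S ^ 4 * (U ^ 2 + |U| * (1 / 2 : ℝ) ^ m)) := by
    intro j hj
    have hjk : j ≤ 1 + k' := by have := mem_range.1 hj; omega
    have hchoose : ((1 + k').choose j : ℝ) ≤ 3 := by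
      have : (1 + k').choose j ≤ 3 := by interval_cases k' <;> interval_cases j <;> simp [Nat.choose]
      exact_mod_cast this
    have hfact : (j.factorial : ℝ) ≤ 6 := by
      have : j.factorial ≤ 6 := by interval_cases k' <;> interval_cases j <;> simp [Nat.factorial]
      exact_mod_cast this
    have hin := hinner j hj
    have hin0 : 0 ≤ (∑ j' ∈ range (1 + k' - j + 1), ((1 + k' - j).choose j' : ℝ) *
        (R.Gfr j' * uPow j' U * (Y ^ (2 * j') / Y ^ 4))) * (Y ^ 2 * (1 / (4 * Y ^ 2)) ^ k' * Y ^ j) := by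
      refine mul_nonneg (sum_nonneg fun j' _ => ?_) (by positivity)
      have hu0 : 0 ≤ uPow j' U := by unfold uPow; split_ifs <;> positivity
      have := hG0 j'
      positivity
    calc ((1 + k').choose j : ℝ) * (j.factorial : ℝ) * (Dc * Y) ^ j *
          (CA * ∑ j' ∈ range (1 + k' - j + 1), ((1 + k' - j).choose j' : ℝ) *
            (R.Gfr j' * uPow j' U * (Y ^ (2 * j') / Y ^ 4))) * (Y ^ 2 * (1 / (4 * Y ^ 2)) ^ k')
        = CA * (((1 + k').choose j : ℝ) * (j.factorial : ℝ) * Dc ^ j) *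
            ((∑ j' ∈ range (1 + k' - j + 1), ((1 + k' - j).choose j' : ℝ) *
              (R.Gfr j' * uPow j' U * (Y ^ (2 * j') / Y ^ 4))) * (Y ^ 2 * (1 / (4 * Y ^ 2)) ^ k' * Y ^ j)) := by
          rw [mul_pow]; ring
      _ ≤ CA * (3 * 6 * (64 * S ^ 3)) * (8 * S * (U ^ 2 + |U| * (1 / 2 : ℝ) ^ m)) := by
          have hCF : ((1 + k').choose j : ℝ) * (j.factorial : ℝ) ≤ 3 * 6 := mul_le_mul hchoose hfact (Nat.cast_nonneg _) (by norm_num)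
          have h1 : ((1 + k').choose j : ℝ) * (j.factorial : ℝ) * Dc ^ j ≤ 3 * 6 * (64 * S ^ 3) :=
            mul_le_mul hCF (hDcj j (by omega)) (by positivity) (by norm_num)
          exact mul_le_mul (mul_le_mul_of_nonneg_left h1 hCA0) hin hin0 (by positivity)
      _ = CA * (9216 * S ^ 4 * (U ^ 2 + |U| * (1 / 2 : ℝ) ^ m)) := by ring
  rw [mul_sum]
  calc ∑ j ∈ range (1 + k' + 1), Y ^ 2 * (1 / (4 * Y ^ 2)) ^ k' * (((1 + k').choose j : ℝ) * (j.factorial : ℝ) * (Dc * Y) ^ j *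
        (CA * ∑ j' ∈ range (1 + k' - j + 1), ((1 + k' - j).choose j' : ℝ) *
          (R.Gfr j' * uPow j' U * (Y ^ (2 * j') / Y ^ 4))))
      ≤ ∑ _j ∈ range (1 + k' + 1), CA * (9216 * S ^ 4 * (U ^ 2 + |U| * (1 / 2 : ℝ) ^ m)) :=
        sum_le_sum fun j hj => by rw [mul_comm]; exact hterm j hj
    _ = (1 + k' + 1 : ℕ) * (CA * (9216 * S ^ 4 * (U ^ 2 + |U| * (1 / 2 : ℝ) ^ m))) := by rw [sum_const, card_range, nsmul_eq_mul]
    _ ≤ 4 * (CA * (9216 * S ^ 4 * (U ^ 2 + |U| * (1 / 2 : ℝ) ^ m))) := by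
        refine mul_le_mul_of_nonneg_right ?_ (by positivity)
        have : (1 + k' + 1 : ℕ) ≤ 4 := by omega
        exact_mod_cast this
    _ = CA * (36864 * S ^ 4 * (U ^ 2 + |U| * (1 / 2 : ℝ) ^ m)) := by ring

/-- **The scaled amplitudes of the `m`-th multiplier increment** (p4's table `multAmp B klE0 (D_c2ᵐ) WK_m t (1+k')`, `t ≤ 2`):
`4ᵐ·(1/(4·4ᵐ))^{k'}·multAmp … t (1+k') ≤ (klE0/2·(1+k'+t)!·B·(2/klE0)^{1+k'+t})·C_A·36864·S⁴·(U² + |U|/2ᵐ)`. -/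
theorem scaledMultAmp_le (hRwf : R.WF) (hCA0 : 0 ≤ CA) (hB1 : 1 ≤ B) (m t : ℕ) {k' : ℕ} (hk' : k' ≤ 2) :
    ((2 : ℝ) ^ m) ^ 2 * (1 / (4 * ((2 : ℝ) ^ m) ^ 2)) ^ k' *
        multAmp B klE0 ((4 + 4 / 3 * (R.Gfr 1 + R.Gfr 2 + R.Gfr 3)) * (2 : ℝ) ^ m)
          (fun i => CA * ∑ j' ∈ range (i + 1), (i.choose j' : ℝ) *
            (R.Gfr j' * uPow j' U * (((2 : ℝ) ^ m) ^ (2 * j') / ((2 : ℝ) ^ m) ^ 4))) t (1 + k') ≤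
      klE0 / 2 * (((1 + k' + t).factorial : ℝ) * B * (2 / klE0) ^ (1 + k' + t)) *
        (CA * (36864 * (1 + R.Gfr 0 + R.Gfr 1 + R.Gfr 2 + R.Gfr 3) ^ 4 * (U ^ 2 + |U| * (1 / 2 : ℝ) ^ m))) := by
  have h := scaled_mult_sum_le (U := U) hRwf hCA0 m hk'
  have hE : (0 : ℝ) < klE0 := by norm_num [klE0]
  have hB0 : 0 ≤ B := zero_le_one.trans hB1
  unfold multAmp
  calc _ = klE0 / 2 * (((1 + k' + t).factorial : ℝ) * B * (2 / klE0) ^ (1 + k' + t)) *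
        (((2 : ℝ) ^ m) ^ 2 * (1 / (4 * ((2 : ℝ) ^ m) ^ 2)) ^ k' *
          ∑ j ∈ range (1 + k' + 1), ((1 + k').choose j : ℝ) * (j.factorial : ℝ) *
            ((4 + 4 / 3 * (R.Gfr 1 + R.Gfr 2 + R.Gfr 3)) * (2 : ℝ) ^ m) ^ j *
              (CA * ∑ j' ∈ range (1 + k' - j + 1), ((1 + k' - j).choose j' : ℝ) *
                (R.Gfr j' * uPow j' U * (((2 : ℝ) ^ m) ^ (2 * j') / ((2 : ℝ) ^ m) ^ 4)))) := by
          push_cast; ring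
    _ ≤ _ := mul_le_mul_of_nonneg_left h (by positivity)

end Pieces

end Summit.HubbardSuperconductivity.HubbardSuperconductivity.Theorems.EngineV8

end
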